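import Summits.BirchSwinnertonDyer.BirchSwinnertonDyer.Theses.EisensteinPrimes
import Summits.BirchSwinnertonDyer.BirchSwinnertonDyer.Theorems.Rank1ResidualX1Isogeny
import Summits.BirchSwinnertonDyer.Rank1Residual.X1.TamagawaSqueeze
import Literature.Barriers.BirchSwinnertonDyer.EisensteinMuConjecture
import Literature.NumberTheory.EllipticCurves.SupersingularIrreducibleProofs
import Literature.NumberTheory.EllipticCurves.AnalyticRankModularityProofs
import Literature.NumberTheory.EllipticCurves.IwasawaAlgebraProofs
import Literature.NumberTheory.EllipticCurves.IwasawaModuleFinitePadicIntProofs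
import HarnessLib

/-!
# Sketch — crux idea `artin-lift-kummer-tower` on `MazurMCOnX1RankZero`
(stmt-BirchSwinnertonDyer-19035; planner seat bsd-eis-idea g15).

At `p = 3` the étale end `E_ét` of an X1 rank-0 class has `E_ét[3] = (1 c; 0 ω)`, which is the reduction
of the Artin lattice `σ_d = Ind_{ℚ(√-3)}^ℚ χ_d` (Kummer class `d ≡ ±1 (9)`). The idea replaces `T_3 E_ét` by
`σ_d`: the two cyclotomic Iwasawa modules are RESIDUAL TWINS (both `X/3X` are quotients of one residual
Selmer group by kernels of order ≤ 3), so `μ` and — once `μ = 0` — `λ` transfer between them by pure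
commutative algebra; the Artin side is a class-group and unit-group module of the Kummer tower `ℚ(μ_{3^∞}, ∛d)`,
abelian over `ℚ(√-3)`, where genus theory, the analytic class number formula and the elliptic-unit main
theorem of Johnson-Leung–Kings 2011 (Thm. 5.2, all primes) are available.

Typed here over TREE declarations only: the twin predicate, the abstract transfer lemma (T1, PROVED), the
Artin-twin interface (existence is a separate construction hypothesis, never a field), the three numerical
shadows K1/T3/K2', and the first lemma of the line (PROVED from the per-curve route-T door
`X1.TamagawaSqueeze.mazurMainConjecture_of_algebraicLambdaGE`). Nothing is asserted; no `sorry`.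
-/

set_option linter.dupNamespace false
set_option autoImplicit false

noncomputable section

open WeierstrassCurve Literature.NumberTheory.EllipticCurves
  Literature.NumberTheory.EllipticCurves.Rank1Residual
open Literature.Barriers.BirchSwinnertonDyer (HasRamifiedOddLineAt)
open Summit.BirchSwinnertonDyer.Rank1Residual
open Summit.BirchSwinnertonDyer.BirchSwinnertonDyer.Theorems
open Summit.BirchSwinnertonDyer.BirchSwinnertonDyer.Theorems.Rank1ResidualX1Defs
open IwasawaAlgebra Literature.NumberTheory.EllipticCurves.IwasawaModuleFinitePadicInt

namespace Summit.BirchSwinnertonDyer.BirchSwinnertonDyer.Cruxes.MazurMCOnX1RankZero.ArtinLift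

universe u v w

section Twin

variable (p : ℕ) [Fact p.Prime]

/-- The residual quotient `X/(p)X` of a `Λ = ℤ_p⟦T⟧`-module (`(p) = augIdealP p`). [folklore] -/
abbrev ResidualQuot (X : Type u) [AddCommGroup X] [Module (IwasawaAlgebra p) X] : Type u :=
  X ⧸ (augIdealP p • (⊤ : Submodule (IwasawaAlgebra p) X))

/-- **Residual twins.** Two `Λ`-modules `X`, `M` are residual twins if their residual quotients `X/(p)X`,
`M/(p)M` are quotients of ONE `Λ`-module `R` by FINITE kernels. (Intended instance: `X = X(E_ét/ℚ_∞)`,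
`M` = the Greenberg–Selmer dual of the Artin lattice `σ_d` over `ℚ_∞`, `R` = the dual of the residual
Selmer group `Sel^Σ(ℚ_∞, E_ét[3]) = Sel^Σ(ℚ_∞, σ_d/3)`, kernels of order `≤ 3` — Greenberg–Vatsal 2000 §2.) [folklore] -/
def IsResidualTwin (X : Type u) (M : Type v) [AddCommGroup X] [Module (IwasawaAlgebra p) X]
    [AddCommGroup M] [Module (IwasawaAlgebra p) M] : Prop :=
  ∃ (R : Type w) (_ : AddCommGroup R) (_ : Module (IwasawaAlgebra p) R)
    (f : R →ₗ[IwasawaAlgebra p] ResidualQuot p X) (g : R →ₗ[IwasawaAlgebra p] ResidualQuot p M),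
    Function.Surjective f ∧ Function.Surjective g ∧ Finite (LinearMap.ker f) ∧ Finite (LinearMap.ker g)

private theorem finite_of_finite_ker_of_finite_quotient {R : Type*} [Ring R] {Q : Type*}
    [AddCommGroup Q] [Module R Q] (N : Submodule R Q) [Finite N] [Finite (Q ⧸ N)] : Finite Q := by
  apply Nat.finite_of_card_ne_zero
  rw [Submodule.card_eq_card_quotient_mul_card N]
  exact mul_ne_zero Nat.card_pos.ne' Nat.card_pos.ne'

/-- **(T1, abstract transfer — PROVED).** Across residual twins, finiteness of the residual quotient
transfers: `X/(p)X` finite ⟹ `M/(p)M` finite. [folklore] -/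
theorem finite_residualQuot_of_twin {X : Type u} {M : Type v} [AddCommGroup X]
    [Module (IwasawaAlgebra p) X] [AddCommGroup M] [Module (IwasawaAlgebra p) M]
    (h : IsResidualTwin.{u, v, w} p X M) (hX : Finite (ResidualQuot p X)) :
    Finite (ResidualQuot p M) := by
  obtain ⟨R, _, _, f, g, hf, hg, hkf, _hkg⟩ := h
  haveI : Finite (R ⧸ LinearMap.ker f) :=
    Finite.of_equiv (ResidualQuot p X) (f.quotKerEquivOfSurjective hf).symm.toEquiv
  haveI : Finite R := finite_of_finite_ker_of_finite_quotient (LinearMap.ker f)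
  exact Finite.of_surjective g hg

/-- **(T1 ⇒ μ).** If `X/(p)X` is finite (e.g. `μ(X) = 0` with `X` f.g. torsion), every finitely
generated torsion residual twin `M` of `X` has `μ(M) = 0` (tree:
`muInvariant_eq_zero_of_finite_quotient_augIdealP`). [folklore] -/
theorem muInvariant_eq_zero_of_twin {X : Type u} (M : Type v) [AddCommGroup X]
    [Module (IwasawaAlgebra p) X] [AddCommGroup M] [Module (IwasawaAlgebra p) M]
    [Module.Finite (IwasawaAlgebra p) M] (hM : Module.IsTorsion (IwasawaAlgebra p) M)
    (h : IsResidualTwin.{u, v, w} p X M) (hX : Finite (ResidualQuot p X)) : muInvariant p M = 0 :=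
  muInvariant_eq_zero_of_finite_quotient_augIdealP p M hM (finite_residualQuot_of_twin p h hX)

/-- **(T1 ⇒ ℤ_p-finite).** Under the same hypothesis the twin `M` is finitely generated over `ℤ_p` — on the
Artin side: «the 3-class groups / unit indices of the Kummer tower have bounded rank» (tree:
`moduleFinite_padicInt_of_finite_quotient_augIdealP`). [folklore] -/
theorem moduleFinite_padicInt_of_twin {X : Type u} (M : Type v) [AddCommGroup X]
    [Module (IwasawaAlgebra p) X] [AddCommGroup M] [Module (IwasawaAlgebra p) M]
    [Module.Finite (IwasawaAlgebra p) M]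
    (h : IsResidualTwin.{u, v, w} p X M) (hX : Finite (ResidualQuot p X)) :
    Module.Finite ℤ_[p] (RestrictScalars ℤ_[p] (IwasawaAlgebra p) M) :=
  moduleFinite_padicInt_of_finite_quotient_augIdealP p M (finite_residualQuot_of_twin p h hX)

end Twin

section ArtinSide

variable (p : ℕ) [Fact p.Prime]

/-- **Interface (no existence smuggled).** An ARTIN TWIN DATUM for `W` over the `ℤ_p`-extension `κ`:
a finitely generated torsion `Λ`-module `M` residually twinned with every Pontryagin-dual Selmer datum
`D.X = X(E/ℚ_∞)`. Intended construction (definition request D1, `p = 3`, étale end, Kummer class `d`):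
`M = X_{𝔭₂⁻}(ℚ_∞(∛d))` = Greenberg–Selmer dual of `σ_d = Ind χ_d` over `ℚ_∞`. [folklore] -/
structure ArtinTwinData (W : WeierstrassCurve ℚ) [W.IsElliptic] (κ : ZpExtension ℚ p)
    (γ : Field.absoluteGaloisGroup ℚ) where
  /-- carrier of the Artin-side Iwasawa module -/
  M : Type
  [addCommGroup : AddCommGroup M]
  [module : Module (IwasawaAlgebra p) M]
  [fg : Module.Finite (IwasawaAlgebra p) M]
  torsion : Module.IsTorsion (IwasawaAlgebra p) M
  twin : ∀ D : W.SelmerDualData κ γ, IsResidualTwin.{_, 0, 0} p D.X M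

attribute [instance] ArtinTwinData.addCommGroup ArtinTwinData.module ArtinTwinData.fg

/-- **D1 (construction statement, hypothesis form).** The Artin twin EXISTS over the cyclotomic tower. [folklore] -/
def ArtinTwinExists (W : WeierstrassCurve ℚ) [W.IsElliptic] : Prop :=
  ∀ (κ : ZpExtension ℚ p) (γ : Field.absoluteGaloisGroup ℚ), κ.IsCyclotomic → κ.IsTopGenerator γ →
    Nonempty (ArtinTwinData p W κ γ)

/-- **K1 shadow («unit filling» / genus).** The Artin module has `μ = 0`. On the class-group part this is
Chevalley–Iwasawa genus theory over the `3`-regular field `ℚ(μ_{3^∞})` (proved-grade); the open part is the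
unit filling at the ramified cubic prime `𝔭₂`. By `muInvariant_eq_zero_of_twin` it also FOLLOWS from
`μ(E_ét) = 0` (Kato–Wuthrich + certified `μ_an = 0`) per certified class. [folklore] -/
def ArtinMuZero (W : WeierstrassCurve ℚ) [W.IsElliptic] : Prop :=
  ∀ (κ : ZpExtension ℚ p) (γ : Field.absoluteGaloisGroup ℚ), κ.IsCyclotomic → κ.IsTopGenerator γ →
    ∀ A : ArtinTwinData p W κ γ, muInvariant p A.M = 0

/-- **T3 shadow (λ-bridge, Greenberg–Vatsal §2 shape).** Once `μ(M) = 0`: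
`λ(X(E/ℚ_∞)) + c_E = λ(M) + c_Art` with explicit finite-kernel corrections. [folklore] -/
def ArtinLambdaBridge (W : WeierstrassCurve ℚ) [W.IsElliptic] (cE cArt : ℕ) : Prop :=
  ∀ (κ : ZpExtension ℚ p) (γ : Field.absoluteGaloisGroup ℚ), κ.IsCyclotomic → κ.IsTopGenerator γ →
    ∀ (A : ArtinTwinData p W κ γ) (D : W.SelmerDualData κ γ) [Module.Finite (IwasawaAlgebra p) D.X],
      D.IsTorsion → muInvariant p A.M = 0 → lambdaInvariant p D.X + cE = lambdaInvariant p A.M + cArt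

/-- **K2' shadow (Artin-side count).** `λ(M) ≥ m`: ideal classes / unit indices of the Kummer tower counted
by genus theory (lower rungs) and by the elliptic-unit main theorem (Johnson-Leung–Kings 2011 Thm 5.2,
specialised to the cyclotomic line) — the characteristic-zero source of Selmer classes. [folklore] -/
def ArtinLambdaGE (W : WeierstrassCurve ℚ) [W.IsElliptic] (m : ℕ) : Prop :=
  ∀ (κ : ZpExtension ℚ p) (γ : Field.absoluteGaloisGroup ℚ), κ.IsCyclotomic → κ.IsTopGenerator γ →
    ∀ A : ArtinTwinData p W κ γ, m ≤ lambdaInvariant p A.M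

/-- The Artin-side inputs give the route-T algebraic input `λ_alg(E) ≥ m + c_Art - c_E`. [folklore] -/
theorem algebraicLambdaGE_of_artin {W : WeierstrassCurve ℚ} [W.IsElliptic] [W.IsGloballyMinimal]
    {cE cArt m : ℕ} (hex : ArtinTwinExists p W) (hμ : ArtinMuZero p W)
    (hbr : ArtinLambdaBridge p W cE cArt) (hm : ArtinLambdaGE p W m) :
    X1.TamagawaSqueeze.AlgebraicLambdaGE W p (m + cArt - cE) := by
  intro κ γ hκ hγ D _ hT
  obtain ⟨A⟩ := hex κ γ hκ hγ
  have h1 := hbr κ γ hκ hγ A D hT (hμ κ γ hκ hγ A)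
  have h2 := hm κ γ hκ hγ A
  omega

end ArtinSide

/-- **First lemma of the line.** At `p = 3`, a rank-`0` X1 member OFF the μ-barrier locus (an étale end),
the Artin twin (D1), its `μ = 0` (K1), the `λ`-bridge (T3), the Artin-side count `λ(M) ≥ m` (K2') and the
analytic match `λ_an(E) + c_E ≤ m + c_Art` (K3, with certified `μ_an = 0`), together with Kato–Wuthrich
divisibility, give Mazur's main conjecture at that member. -/
def FirstLemma : Prop :=
  ∀ (W : WeierstrassCurve ℚ) [W.IsElliptic] [W.IsGloballyMinimal] [Fact (3 : ℕ).Prime],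
    ClassX1 W 3 → W.analyticRank = 0 → ¬ HasRamifiedOddLineAt W 3 →
    ArtinTwinExists 3 W → ArtinMuZero 3 W →
    (∃ cE cArt m n : ℕ, ArtinLambdaBridge 3 W cE cArt ∧ ArtinLambdaGE 3 W m ∧
        X1.ParitySqueeze.AnalyticLambdaEq W 3 n ∧ n + cE ≤ m + cArt) →
    X1.MuPart.AnalyticMuLE W 3 0 →
    Wuthrich2014.charIdeal_dvd_padicLFunction → MazurMainConjecture W 3

/-- **The first lemma holds in the tree**, so the idea's open content is exactly D1 ∧ K1 ∧ T3 ∧ K2' ∧ K3. -/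
theorem firstLemma_holds : FirstLemma := by
  intro W _ _ _ hX1 _hr0 _hoff hex hμA hdata hμan hW16
  obtain ⟨cE, cArt, m, n, hbr, hm, hlam, hnm⟩ := hdata
  have hp2 : 2 < 3 := hX1.1
  have hred : Red W 3 := hX1.2.1
  have hgood : Good W 3 := hX1.2.2.1
  have hp : (3 : ℕ) ≠ 2 := by omega
  obtain ⟨-, hord⟩ := goodOrd_of_red_of_good W 3 hp2 hgood hred
  have hμ : X1.MuLambda.MuPartAt W 3 :=
    X1.MuPart.muPartAt_of_analyticMuLE_zero hW16 hp hgood hord hred hμan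
  exact X1.TamagawaSqueeze.mazurMainConjecture_of_algebraicLambdaGE hW16 hp hgood hord hred hμ hlam
    (algebraicLambdaGE_of_artin 3 hex hμA hbr hm) (by omega)

end Summit.BirchSwinnertonDyer.BirchSwinnertonDyer.Cruxes.MazurMCOnX1RankZero.ArtinLift

end
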